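import Summits.QuantumAdvantage.QuantumAdvantage.Theorems.LinnikCubicClassGroupsDegreeOnePrimesEscapeResidueBrauerSiegel
import Summits.QuantumAdvantage.QuantumAdvantage.Theorems.LinnikCubicClassGroupsDegreeOnePrimesEscapeResidueUpper
import Literature.NumberTheory.NumberFields.UnitHeightGap
import Mathlib.Analysis.SpecialFunctions.Pow.Asymptotics
import HarnessLib

/-!
# The Brauer–Siegel theorem in every fixed degree: `log(h_K R_K) ∼ ½ log|d_K|` for EVERY number field

Topic `Summits/QuantumAdvantage/QuantumAdvantage/Theorems`, cell B2b-1 (linnik-cubic), PART A (gen 10); helper file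
of the (closed) crux `DegreeOnePrimesEscape` (stmt-QuantumAdvantage-11543) of route `LinnikCubicClassGroups`.
HONEST FRAMING: the value of this file is a THEOREM (kernel-checked, GRH-free, no hypothesis; the lower bound is
INEFFECTIVE through Siegel's theorem) — NOT summit progress.

**Theorem (Siegel 1935 for `n = 2`, Brauer 1947; every field of FIXED degree by Stark's reduction of the
exceptional zero to a quadratic subfield).**  For every `n > 1` and every `ε > 0`:

* `abs_log_classNumber_mul_regulator_sub_le` — there is `C = C(n, ε)` with
  `|log(h_K R_K) − ½ log|d_K|| ≤ ε log|d_K| + C` for EVERY number field `K` of degree `n`;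
* `brauerSiegel` — there is `D₀ = D₀(n, ε)` with `|log(h_K R_K) − ½ log|d_K|| ≤ ε log|d_K|` for every number
  field `K` of degree `n` with `|d_K| ≥ D₀`, i.e. `log(h_K R_K) / log √|d_K| → 1` as `|d_K| → ∞` through the
  number fields of degree `n` (Lang, *Algebraic Number Theory*, Ch. XVI, Theorem 4 for fixed degree, where the
  normality hypothesis is unnecessary by [Stark1974]).

Assembly of two theorems of the tree: the ineffective lower bound `C(n,ε)|d_K|^{1/2−ε} ≤ h_K R_K` for every
field of degree `n` (`Residue.classNumber_mul_regulator_ge`: Siegel's theorem for the quadratic Dirichlet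
`L`-function carrying the exceptional zero of `ζ_K`, Stark's Lemma 4) and Landau's upper bound
`h_K R_K ≤ 2√e · w_K · √|d_K| · log^{n−1}|d_K|` (`Residue.classNumber_mul_regulator_le_sqrt_mul_log_pow`) with
`w_K ≤ W(n)` (`exists_torsionOrder_le_of_finrank_le`).

References: C. L. Siegel, Acta Arith. 1 (1935) 83–86; R. Brauer, Amer. J. Math. 69 (1947) 243–250 [folklore];
H. M. Stark, Invent. Math. 23 (1974) 135–152 [Stark1974]; S. Lang, *Algebraic Number Theory*, 2nd ed., Ch. XVI §4
[folklore]; H. L. Montgomery, R. C. Vaughan, *Multiplicative Number Theory I*, Cor. 11.15 [MontgomeryVaughan2007].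
-/

noncomputable section

open Filter Asymptotics NumberField NumberField.InfinitePlace NumberField.Units

namespace Summit.QuantumAdvantage.QuantumAdvantage.Theorems.DegreeOnePrimesEscape

namespace Residue

open Literature.NumberTheory.NumberFields

/-- **Brauer–Siegel with an additive constant, every number field of degree `n`**: for `n > 1` and `ε > 0`
there is `C` with `|log(h_K R_K) − ½ log|d_K|| ≤ ε log|d_K| + C` for every number field `K` of degree `n`
(ineffective `C`). [cite: Stark1974, §1] [cite: MontgomeryVaughan2007, Corollary 11.15] -/
theorem abs_log_classNumber_mul_regulator_sub_le (n : ℕ) (hn : 1 < n) {ε : ℝ} (hε : 0 < ε) :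
    ∃ C : ℝ, ∀ (K : Type) [Field K] [NumberField K], Module.finrank ℚ K = n →
      |Real.log ((classNumber K : ℝ) * regulator K) - Real.log |(discr K : ℝ)| / 2| ≤
        ε * Real.log |(discr K : ℝ)| + C := by
  obtain ⟨c, hc, hlow⟩ := classNumber_mul_regulator_ge n hn hε
  obtain ⟨W, hW⟩ := exists_torsionOrder_le_of_finrank_le n
  -- `(n-1) log L ≤ ε L + C₁` for all `L > 0`: from `log y ≤ y` at `y = L`
  set B : ℝ := 2 * Real.exp (1 / 2) * max (W : ℝ) 1 with hB
  have hB0 : 0 < B := by positivity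
  refine ⟨max (Real.log (1 / c)) (Real.log B + ((n : ℝ) - 1) * (Real.log ((n - 1) / ε) + 1)),
    fun K _ _ hKn => ?_⟩
  set X : ℝ := (classNumber K : ℝ) * regulator K with hX
  set d : ℝ := |(discr K : ℝ)| with hd
  have hK1 : 1 < Module.finrank ℚ K := by rw [hKn]; exact hn
  have h1 := hlow K hKn
  have h2 := classNumber_mul_regulator_le_sqrt_mul_log_pow K hK1
  rw [← hX, ← hd, hKn] at h2
  have hdnat : ((discr K).natAbs : ℝ) = d := by rw [hd, Nat.cast_natAbs, Int.cast_abs]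
  rw [hdnat, ← hX] at h1
  -- sizes
  have hX0 : 0 < X := mul_pos (by exact_mod_cast classNumber_pos K) (regulator_pos K)
  have hd3 : (3 : ℝ) ≤ d := by
    have h2' := NumberField.abs_discr_gt_two (K := K) hK1
    rw [hd, ← Int.cast_abs]
    exact_mod_cast (show (3 : ℤ) ≤ |discr K| by omega)
  have hd0 : 0 < d := by linarith
  set L : ℝ := Real.log d with hL
  have hL1 : 1 < L := by
    rw [hL, Real.lt_log_iff_exp_lt hd0]
    have := Real.exp_one_lt_d9; linarith
  have hL0 : 0 < L := by linarith
  have hn1 : (1 : ℝ) ≤ (n : ℝ) - 1 := by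
    have : (2 : ℝ) ≤ n := by exact_mod_cast hn
    linarith
  have hn10 : (0 : ℝ) < (n : ℝ) - 1 := by linarith
  have hcast : ((n - 1 : ℕ) : ℝ) = (n : ℝ) - 1 := by
    rw [Nat.cast_sub hn.le]; simp
  -- the torsion factor
  have hwW : (torsionOrder K : ℝ) ≤ max (W : ℝ) 1 :=
    le_trans (by exact_mod_cast hW K hKn.le) (le_max_left _ _)
  have h2' : X ≤ B * Real.sqrt d * L ^ (n - 1) := by
    refine h2.trans ?_
    have hq : 0 ≤ Real.sqrt d * L ^ (n - 1) := by positivity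
    calc 2 * Real.exp (1 / 2) * torsionOrder K * Real.sqrt d * L ^ (n - 1)
        = 2 * Real.exp (1 / 2) * torsionOrder K * (Real.sqrt d * L ^ (n - 1)) := by ring
      _ ≤ 2 * Real.exp (1 / 2) * max (W : ℝ) 1 * (Real.sqrt d * L ^ (n - 1)) := by
          apply mul_le_mul_of_nonneg_right _ hq
          exact mul_le_mul_of_nonneg_left hwW (by positivity)
      _ = B * Real.sqrt d * L ^ (n - 1) := by rw [hB]; ring
  have hsd0 : 0 < Real.sqrt d := Real.sqrt_pos.mpr hd0
  have hsqrt : Real.log (Real.sqrt d) = L / 2 := by rw [Real.log_sqrt hd0.le]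
  -- upper: `log X ≤ log B + L/2 + (n-1) log L`
  have hup' : Real.log X ≤ Real.log B + L / 2 + ((n : ℝ) - 1) * Real.log L := by
    have h3 : Real.log X ≤ Real.log (B * Real.sqrt d * L ^ (n - 1)) := Real.log_le_log hX0 h2'
    have h4 : Real.log (B * Real.sqrt d * L ^ (n - 1)) =
        Real.log B + L / 2 + ((n : ℝ) - 1) * Real.log L := by
      rw [Real.log_mul (by positivity) (pow_ne_zero _ hL0.ne'), Real.log_mul hB0.ne' hsd0.ne', hsqrt,
        Real.log_pow, hcast]
    linarith
  -- `(n-1) log L ≤ ε L + (n-1) (log((n-1)/ε) + 1)`: `log L = log((n-1)/ε) + log (εL/(n-1))` and `log y ≤ y`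
  have hlogL : ((n : ℝ) - 1) * Real.log L ≤ ε * L + ((n : ℝ) - 1) * (Real.log ((n - 1) / ε) + 1) := by
    have hy0 : 0 < ε * L / ((n : ℝ) - 1) := by positivity
    have hsplit : Real.log L = Real.log (((n : ℝ) - 1) / ε) + Real.log (ε * L / ((n : ℝ) - 1)) := by
      rw [← Real.log_mul (by positivity) hy0.ne']
      congr 1; field_simp
    have hy : Real.log (ε * L / ((n : ℝ) - 1)) ≤ ε * L / ((n : ℝ) - 1) :=
      (Real.log_le_sub_one_of_pos hy0).trans (by linarith)
    have h5 : ((n : ℝ) - 1) * Real.log (ε * L / ((n : ℝ) - 1)) ≤ ε * L := by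
      calc ((n : ℝ) - 1) * Real.log (ε * L / ((n : ℝ) - 1))
          ≤ ((n : ℝ) - 1) * (ε * L / ((n : ℝ) - 1)) := mul_le_mul_of_nonneg_left hy hn10.le
        _ = ε * L := by field_simp
    rw [hsplit, mul_add]
    nlinarith
  -- lower: `log c + (1/2 - ε) L ≤ log X`
  have hlow' : Real.log c + (1 / 2 - ε) * L ≤ Real.log X := by
    have h3 : Real.log (c * d ^ (1 / 2 - ε)) ≤ Real.log X := Real.log_le_log (by positivity) h1
    have h4 : Real.log (c * d ^ (1 / 2 - ε)) = Real.log c + (1 / 2 - ε) * L := by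
      rw [Real.log_mul hc.ne' (Real.rpow_pos_of_pos hd0 _).ne', Real.log_rpow hd0]
    linarith
  have hlogc : Real.log (1 / c) = -Real.log c := by rw [one_div, Real.log_inv]
  have hM1 : Real.log (1 / c) ≤
      max (Real.log (1 / c)) (Real.log B + ((n : ℝ) - 1) * (Real.log ((n - 1) / ε) + 1)) := le_max_left _ _
  have hM2 : Real.log B + ((n : ℝ) - 1) * (Real.log ((n - 1) / ε) + 1) ≤
      max (Real.log (1 / c)) (Real.log B + ((n : ℝ) - 1) * (Real.log ((n - 1) / ε) + 1)) := le_max_right _ _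
  rw [abs_le]
  constructor
  · nlinarith
  · linarith

/-- **The Brauer–Siegel theorem in every fixed degree, every number field** (ineffective threshold): for
`n > 1` and `ε > 0` there is `D₀` such that every number field `K` of degree `n` with `|d_K| ≥ D₀` satisfies
`|log(h_K R_K) − ½ log|d_K|| ≤ ε · log|d_K|`; that is, `log(h_K R_K) ∼ log √|d_K|` as `|d_K| → ∞` through the
number fields of degree `n`. [cite: Stark1974, §1] [cite: MontgomeryVaughan2007, Corollary 11.15] -/
theorem brauerSiegel (n : ℕ) (hn : 1 < n) {ε : ℝ} (hε : 0 < ε) :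
    ∃ D₀ : ℝ, ∀ (K : Type) [Field K] [NumberField K], Module.finrank ℚ K = n →
      D₀ ≤ |(discr K : ℝ)| →
      |Real.log ((classNumber K : ℝ) * regulator K) - Real.log |(discr K : ℝ)| / 2| ≤
        ε * Real.log |(discr K : ℝ)| := by
  obtain ⟨C, hC⟩ := abs_log_classNumber_mul_regulator_sub_le n hn (half_pos hε)
  -- threshold: `C ≤ (ε/2) log D₀`
  refine ⟨max 3 (Real.exp (2 * max C 0 / ε)), fun K _ _ hKn hD => ?_⟩
  set d : ℝ := |(discr K : ℝ)| with hd
  have hd3 : (3 : ℝ) ≤ d := le_trans (le_max_left _ _) hD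
  have hd0 : 0 < d := by linarith
  have hlogd : 2 * max C 0 / ε ≤ Real.log d := by
    rw [Real.le_log_iff_exp_le hd0]
    exact le_trans (le_max_right _ _) hD
  have hC0 : C ≤ max C 0 := le_max_left _ _
  have hCle : C ≤ ε / 2 * Real.log d := by
    have : 2 * max C 0 ≤ ε * Real.log d := by
      rwa [div_le_iff₀' hε] at hlogd
    linarith
  have h := hC K hKn
  rw [← hd] at h
  linarith

/-- **Class-number form for fields with bounded regulator** — e.g. every imaginary quadratic field
(`R_K = 1`): for `n > 1`, `ε > 0` and any `R₀` there is `D₀` such that every number field `K` of degree `n` with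
`R_K ≤ R₀` and `|d_K| ≥ D₀` has `|log h_K − ½ log|d_K|| ≤ ε log|d_K|` (the regulator of every number field of
degree `n` is `≥ c(n) > 0`, `exists_regulator_ge_of_finrank_le`). [cite: Stark1974, §1] -/
theorem brauerSiegel_classNumber_of_regulator_le (n : ℕ) (hn : 1 < n) {ε : ℝ} (hε : 0 < ε) (R₀ : ℝ) :
    ∃ D₀ : ℝ, ∀ (K : Type) [Field K] [NumberField K], Module.finrank ℚ K = n → regulator K ≤ R₀ →
      D₀ ≤ |(discr K : ℝ)| →
      |Real.log (classNumber K : ℝ) - Real.log |(discr K : ℝ)| / 2| ≤ ε * Real.log |(discr K : ℝ)| := by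
  obtain ⟨C, hC⟩ := abs_log_classNumber_mul_regulator_sub_le n hn (half_pos hε)
  obtain ⟨c, hc, hreg⟩ := exists_regulator_ge_of_finrank_le n
  -- `|log R_K| ≤ M := max (log R₀) (log (1/c))`
  set M : ℝ := max (Real.log R₀) (Real.log (1 / c)) with hM
  refine ⟨max 3 (Real.exp (2 * (max C 0 + max M 0) / ε)), fun K _ _ hKn hRK hD => ?_⟩
  set d : ℝ := |(discr K : ℝ)| with hd
  have hd3 : (3 : ℝ) ≤ d := le_trans (le_max_left _ _) hD
  have hd0 : 0 < d := by linarith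
  have hlogd : 2 * (max C 0 + max M 0) / ε ≤ Real.log d := by
    rw [Real.le_log_iff_exp_le hd0]
    exact le_trans (le_max_right _ _) hD
  have hCM : 2 * (max C 0 + max M 0) ≤ ε * Real.log d := by rwa [div_le_iff₀' hε] at hlogd
  have hC0 : C ≤ max C 0 := le_max_left _ _
  have hM0 : M ≤ max M 0 := le_max_left _ _
  have hR0 : 0 < regulator K := regulator_pos K
  have hh0 : (0 : ℝ) < classNumber K := by exact_mod_cast classNumber_pos K
  have hRc : c ≤ regulator K := hreg K hKn.le
  have hlogR : |Real.log (regulator K)| ≤ M := by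
    rw [abs_le]
    constructor
    · have h1 : Real.log c ≤ Real.log (regulator K) := Real.log_le_log hc hRc
      have h2 : Real.log (1 / c) = -Real.log c := by rw [one_div, Real.log_inv]
      have h3 : Real.log (1 / c) ≤ M := le_max_right _ _
      linarith
    · exact (Real.log_le_log hR0 hRK).trans (le_max_left _ _)
  have h := hC K hKn
  rw [← hd, Real.log_mul hh0.ne' hR0.ne'] at h
  rw [abs_le] at h hlogR ⊢
  constructor <;> linarith [h.1, h.2, hlogR.1, hlogR.2]

end Residue

end Summit.QuantumAdvantage.QuantumAdvantage.Theorems.DegreeOnePrimesEscape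

end
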